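import Summits.Ventures.Crystal3D.Theorems.StickyWulffConstantCoaxialWallLawTailResidueDefsU
import Summits.Ventures.Crystal3D.Theorems.StickyWulffConstantCoaxialWallLawTailResidueClosingT5
import HarnessLib

/-!
# The lane-F closing theorem on the U-A1 / SEAM-RESIDUAL split of T5b: `… → MultiGrainSmallLow (2√6) 3 → JammedOneSmall (2√6) 3 →
# (KissingGap → KissingClassification → SeamResidual (2√6) 3) → CoaxialWallLaw` (crux `CoaxialWallLaw`, stmt-Ventures-19481; definitions `…TailResidueDefsU`)

HONEST FRAMING. Venture `Summits/Ventures/Crystal3D` (cell `crystal3d-full`); helper `--supports` the crux `CoaxialWallLaw` (stmt-Ventures-19481,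
`route-Ventures-StickyWulffConstant`), registered line 'CoaxialWallLawCertificates' v4 (planner cf-p1; a v5 would register on this file).  Rung credit; F-C1 NOT
moved.  `…TailResidueClosingT5` (p711514) closed the crux by name on `… ∧ MultiGrainSmallLow (2√6) 3 ∧ (kissing facts → MultiGrainSmallHigh (2√6) 3)`;
`…TailResidueDefsU` re-cuts the last binder by the U-A1 shape predicate `JammedOneAt` (one jammed ball of `≤ 3` contacts over an on-site 𝒰_cx window):
the U-A1 half `JammedOneSmall` is the target of a finite rational census through `…JammedBall`, the `SeamResidual` half (bi-module junctions, several dust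
balls, dense junk) stays under the kissing facts.
* **`coaxialWallLaw_of_lensCertificates_jammed_split`** — the v4 cone with `KissingGap (5/2) → KissingClassification (5/2) → MultiGrainSmallHigh (2√6) 3`
  replaced by the pair `JammedOneSmall (2√6) 3`, `KissingGap (5/2) → KissingClassification (5/2) → SeamResidual (2√6) 3` (twelve binders; proposed v5 stubs
  `stub_jammedOneSmall`, `stub_seamResidual`);
* `coaxialWallLaw_of_lensCertificates_jammed_explicit` — the same with the low half discharged by `TailResidue.multiGrainSmallLow_three` (eleven binders).
REMAINING BY-NAME DEBTS: `P5Exhaustion`; the two on-site flats; `LensCert (2√6)`; `JammedOneSmall (2√6) 3` [U-A1 census + reduction]; `SeamResidual (2√6) 3`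
under the kissing facts [OPEN; U-A3 junction census ≤ 1.25 numerically; dense junk = `LocalBarlowRigidity`, owner 19481-p1].  WHAT THIS IS NOT: not those;
F-C1 not moved.
-/

noncomputable section

namespace Summit.Ventures.Crystal3D.Theorems

open Summit.Ventures.Crystal3D Finset TailResidue
open scoped InnerProductSpace

/-- **THE LANE-F CONE ON THE U-A1 / SEAM-RESIDUAL SPLIT** (composition for a 'Certificates' v5): the v4 cone `coaxialWallLaw_of_lensCertificates_split` with
its last binder re-assembled from `JammedOneSmall (2√6) 3` (kissing-free) and `KissingGap (5/2) → KissingClassification (5/2) → SeamResidual (2√6) 3`. -/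
theorem coaxialWallLaw_of_lensCertificates_jammed_split (hg : KissingGap (5 / 2)) (hc : KissingClassification (5 / 2))
    (hSP : StarPairFar) (hE1 : P5Exhaustion) (honT : EndRowOnSiteFlatA WordVersion.v2 (9 / 2) coaxialModuleUniverse)
    (honJ : EndRowOnSiteJointFlatA WordVersion.v2 (2 * Real.sqrt 6) coaxialModuleUniverse)
    (hcert : LensCert (2 * Real.sqrt 6)) (hmono : MonoCapture) (hmod : ModuleCapture)
    (hlow : MultiGrainSmallLow (2 * Real.sqrt 6) 3) (hjam : JammedOneSmall (2 * Real.sqrt 6) 3)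
    (hres : KissingGap (5 / 2) → KissingClassification (5 / 2) → SeamResidual (2 * Real.sqrt 6) 3) :
    Summit.Ventures.Crystal3D.Theses.StickyWulffConstant.CoaxialWallLaw :=
  coaxialWallLaw_of_lensCertificates_split hg hc hSP hE1 honT honJ hcert hmono hmod hlow
    fun hg' hc' => multiGrainSmallHigh_of_jammedOne_of_residual hjam (hres hg' hc')

/-- **The cone with the low half discharged** (eleven binders): `… → ModuleCapture → JammedOneSmall (2√6) 3 → (KissingGap (5/2) → KissingClassification (5/2) →
SeamResidual (2√6) 3) → CoaxialWallLaw`. -/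
theorem coaxialWallLaw_of_lensCertificates_jammed_explicit (hg : KissingGap (5 / 2)) (hc : KissingClassification (5 / 2))
    (hSP : StarPairFar) (hE1 : P5Exhaustion) (honT : EndRowOnSiteFlatA WordVersion.v2 (9 / 2) coaxialModuleUniverse)
    (honJ : EndRowOnSiteJointFlatA WordVersion.v2 (2 * Real.sqrt 6) coaxialModuleUniverse)
    (hcert : LensCert (2 * Real.sqrt 6)) (hmono : MonoCapture) (hmod : ModuleCapture)
    (hjam : JammedOneSmall (2 * Real.sqrt 6) 3)
    (hres : KissingGap (5 / 2) → KissingClassification (5 / 2) → SeamResidual (2 * Real.sqrt 6) 3) :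
    Summit.Ventures.Crystal3D.Theses.StickyWulffConstant.CoaxialWallLaw :=
  coaxialWallLaw_of_lensCertificates_jammed_split hg hc hSP hE1 honT honJ hcert hmono hmod multiGrainSmallLow_three hjam hres

end Summit.Ventures.Crystal3D.Theorems

end
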